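import Literature.NumberTheory.EllipticCurves.Rank1Residual.PrintShapeTorsion
import Literature.NumberTheory.EllipticCurves.Rank1Residual.Predicates
import Literature.NumberTheory.EllipticCurves.JetchevSkinnerWan2017.RankOnePPart
import Literature.NumberTheory.EllipticCurves.LeadingTermPPartRankLeOne
import Literature.NumberTheory.EllipticCurves.Skinner2016.RankZeroPPart
import Literature.NumberTheory.EllipticCurves.LFunctionPrimeCoeff
import Literature.NumberTheory.EllipticCurves.RootNumberTwistProofs
import Literature.NumberTheory.DiophantineGeometry.GeneralizedFermatTwoPowerCoefficientFreySaitoProofs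
import HarnessLib

/-!
# Dedup bridges for the rank-≤1 residual cell (referee R6.6 / R6.7) — theorems only

HONEST FRAMING (run/shared/lean/b2b/bsd-rank1-residual/): the cell DELETES combination-shaped
residual classes of analytic-rank `≤ 1` curves over `ℚ` strictly from published theorems and TYPES
the construction-shaped ones; this is not "finishing BSD". This file adds no statement of the
literature: it proves that the several tree SPELLINGS of one printed display, and of one printed
theorem, are interchangeable, so that the paper cites ONE declaration per published result
(referee rulings R6.6 "dedup duty" and R6.7 "the paper cites `PPart` + `bsdp_of_pPart`").

## 1. Semistability, three spellings
`Rank1Residual.Semistable W` (primewise: good or multiplicative `ℤ_ℓ`-minimal model at every prime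
`ℓ`), the tree's `W.IsSemistable ℤ` (every finite place of `ℤ`) and `W.IsSemistable (𝓞 ℚ)` (every
finite place of `𝓞 ℚ`, the spelling of `JetchevSkinnerWan2017.thm121_padicValRat_bsd_rank_one`)
are equivalent for an elliptic curve over `ℚ`: `semistable_iff_isSemistable_int`,
`isSemistable_int_iff_isSemistable_ringOfIntegers`, `semistable_iff_isSemistable_ringOfIntegers`
(transport along `ℚ_v ≃ ℚ_[p]`, tree lemmas `hasGoodReductionAtPrime_primesEquiv_iff_hasGoodReductionAt`,
`…_ringOfIntegers` and their multiplicative analogues; the direction `ℤ ⇒ 𝓞 ℚ` is the tree's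
`isSemistable_ringOfIntegers_of_isSemistable_int`).

## 2. Jetchev–Skinner–Wan 2017, Thm. 1.2.1, two spellings
* `JetchevSkinnerWan2017.thm121_padicValRat_bsd_rank_one` (`JetchevSkinnerWan2017/RankOnePPart`,
  this cell): the printed theorem in full — semistable over `𝓞 ℚ`, good `p ≥ 3`, the `p = 3`
  clause "`a_3 = 0` if supersingular", display WITH the torsion term
  `L'(E,1) = q · Reg · Ω`, `ord_p q = ord_p #Ш + ord_p ∏ c_ℓ − 2 ord_p #E(ℚ)_tors`;
* `JetchevSkinnerWan2017_padicValRat_bsd_rank_one_ordinary` (`LeadingTermPPartRankLeOne`,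
  bsd-percentage seat): its ORDINARY case — semistable over `ℤ`, `p ∤ a_p`, display without torsion
  term `ord_p (L'(E,1)/(Reg · Ω)) = ord_p #Ш + ord_p ∏ c_ℓ`.
`jsw_ordinary_of_thm121` proves the first implies the second (the torsion term vanishes under
(irr), `padicValNat_torsionOrder_eq_zero_of_irreducible`; `Reg · Ω ≠ 0`), and
`JetchevSkinnerWan2017.thm121_display_of_ordinary` recovers the first's display from the second on
the ordinary locus. So a class theorem citing either cites ONE theorem (Camb. J. Math. 5 (2017)
Thm. 1.2.1).

## 3. The print shapes, one currency (R6.7)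
The tree has four bridges "printed display ⇒ `BSDp`" (`bsdp_of_padicVal_printShape` /
`_rankZero` in `PrintShape`, `bsdp_of_pPart` / `bsdp_of_pPartRankZero` in `PrintShapeTorsion`,
`bsdp_of_padicValRat_eq` in `X10Proofs`, `bsdp_of_padicValRat_rank_zero` in
`LeadingTermPPartEisensteinProofs`). Their hypothesis shapes are: (a) `PPart` (quotient
`L^{(r)}/(Ω·Reg)`, torsion term), (b) the Yan–Zhu / JSW product display `L^{(r)} = q·Reg·Ω` with
torsion term (`bsdp_of_padicValRat_eq`, `YanZhu2026.thm415_…`, `JetchevSkinnerWan2017.thm121_…`),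
(c) the quotient without torsion term (`bsdp_of_padicVal_printShape`; Castella, BCS Cor. 1.3.1,
Skinner–Zhang, with `(Ω·Reg : ℝ)`; JSW-ordinary with `(Reg : ℂ)·(Ω : ℂ)`), (d) rank `0`:
`PPartRankZero` = the hypothesis of `bsdp_of_padicValRat_rank_zero` verbatim (Skinner–Urban Thm. 2,
Skinner Thm. C as `Skinner2016.thmC_…`), (e) rank `0` without torsion term
(`bsdp_of_padicVal_printShape_rankZero`, `Skinner2016_padicValRat_bsd_rank_zero`). One-line `iff`s:
`pPart_iff_productShape` ((a) ↔ (b)), `pPart_iff_noTorsionShape` and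
`pPart_iff_noTorsionShape_regMulPeriod` ((a) ↔ (c) under (irr)), `pPartRankZero_iff_torsionShape`
((d), `Iff.rfl`), `pPartRankZero_iff_noTorsionShape` ((d) ↔ (e) under (irr)).

## 4. Skinner 2016, Thm. C, two spellings (ARM P dedup, cell `bsd-cited`)
* `Skinner2016.thmC_padicValRat_bsd_rank_zero` (`Skinner2016/RankZeroPPart`, the H1 binder `hSk` of
  `Summit.BirchSwinnertonDyer.Rank1Residual.bsdp_allCurves_of_not_corner_of_not_cornerF`): shape (d),
  display WITH the torsion term;
* `Skinner2016_padicValRat_bsd_rank_zero` (`LeadingTermPPartRankLeOne`, the binder `hSk` of the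
  bsd-percentage `HeightDensity…` theorems): shape (e), display without torsion term.
Their hypotheses are verbatim the same (`p ≥ 3`, good ordinary or multiplicative, (irr), (ram),
`L(E,1) ≠ 0`, `Ш` finite), so `skinner2016_noTorsion_iff_thmC` proves them EQUIVALENT by
`pPartRankZero_iff_noTorsionShape`; the already-landed `Skinner2016.padicValRat_bsd_rank_zero_of_thmC`
(`RankZeroPPart`) feeds Skinner–Urban's Thm. 2 (a) spelling `padicValRat_bsd_rank_zero` from the same
binder. So ONE referee reading of Pacific J. Math. 283 (2016) Thm. C grades all three names.

References: Jetchev–Skinner–Wan, Camb. J. Math. 5 (2017) Thm. 1.2.1 (`JetchevSkinnerWan2017`);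
Yan–Zhu 2026 Thm. 4.15 (`YanZhu2026`); Skinner 2016 Thm. C (`Skinner2016PacificMC`); Miller 2011
Def. 1.1 (`Miller2011LMS`); Mazur 1977 III.5 (torsion vs irreducibility); Silverman AEC VII.5
(reduction types), VIII.9.7 (`Reg > 0`).
-/

noncomputable section

open scoped Classical NumberField

open WeierstrassCurve IsDedekindDomain Literature.NumberTheory.EllipticCurves
  Literature.NumberTheory.EllipticCurves.Rank1Residual

namespace Literature.NumberTheory.EllipticCurves.Rank1Residual

/-! ## 1. Semistability: `Semistable W` ↔ `W.IsSemistable ℤ` ↔ `W.IsSemistable (𝓞 ℚ)` -/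

section Semistable

variable (W : WeierstrassCurve ℚ) [W.IsElliptic]

/-- The cell's primewise `Semistable W` is the tree's `W.IsSemistable ℤ` (semistable at every
finite place of `ℤ`): both read the reduction type on the `ℤ_ℓ`-minimal model, transported along
`ℚ_v ≃ ℚ_[ℓ]`. Silverman, AEC VII.5. [cite: SilvermanAEC2009, VII.5 Prop. 5.1] -/
theorem semistable_iff_isSemistable_int : Semistable W ↔ W.IsSemistable ℤ := by
  constructor
  · intro h v
    haveI := Fact.mk (Rat.HeightOneSpectrum.primesEquiv v).2
    rcases h (Rat.HeightOneSpectrum.primesEquiv v) (Rat.HeightOneSpectrum.primesEquiv v).2 with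
      hg | hm
    · exact Or.inl ((hasGoodReductionAtPrime_primesEquiv_iff_hasGoodReductionAt W v).mp hg)
    · exact Or.inr
        ((hasMultiplicativeReductionAtPrime_primesEquiv_iff_hasMultiplicativeReductionAt W v).mp hm)
  · intro h ℓ hℓ
    set v := (Rat.HeightOneSpectrum.primesEquiv (R := ℤ)).symm ⟨ℓ, hℓ⟩ with hv_def
    have hv : Rat.HeightOneSpectrum.primesEquiv v = ⟨ℓ, hℓ⟩ := Equiv.apply_symm_apply _ _
    have key : ∀ q : Nat.Primes, Rat.HeightOneSpectrum.primesEquiv v = q →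
        (haveI := Fact.mk q.2;
          W.HasGoodReductionAtPrime (q : ℕ) ∨ W.HasMultiplicativeReductionAtPrime (q : ℕ)) := by
      rintro q rfl
      rcases h v with hg | hm
      · exact Or.inl ((hasGoodReductionAtPrime_primesEquiv_iff_hasGoodReductionAt W v).mpr hg)
      · exact Or.inr
          ((hasMultiplicativeReductionAtPrime_primesEquiv_iff_hasMultiplicativeReductionAt W v).mpr
            hm)
    exact key ⟨ℓ, hℓ⟩ hv

/-- Semistability over `𝓞 ℚ` implies semistability over `ℤ` (converse of the tree's
`isSemistable_ringOfIntegers_of_isSemistable_int`): the places of `𝓞 ℚ` and of `ℤ` above `ℓ`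
carry the same reduction type, both read on the `ℤ_ℓ`-minimal model. [cite: SilvermanAEC2009, VII.5 Prop. 5.1] -/
theorem isSemistable_int_of_isSemistable_ringOfIntegers (h : W.IsSemistable (𝓞 ℚ)) :
    W.IsSemistable ℤ := by
  rw [← semistable_iff_isSemistable_int]
  intro ℓ hℓ
  set v' := (Rat.HeightOneSpectrum.primesEquiv (R := 𝓞 ℚ)).symm ⟨ℓ, hℓ⟩ with hv'_def
  have hv : Rat.HeightOneSpectrum.primesEquiv v' = ⟨ℓ, hℓ⟩ := Equiv.apply_symm_apply _ _
  have key : ∀ q : Nat.Primes, Rat.HeightOneSpectrum.primesEquiv v' = q →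
      (haveI := Fact.mk q.2;
        W.HasGoodReductionAtPrime (q : ℕ) ∨ W.HasMultiplicativeReductionAtPrime (q : ℕ)) := by
    rintro q rfl
    rcases h v' with hg | hm
    · exact Or.inl
        ((hasGoodReductionAtPrime_iff_hasGoodReductionAt_ringOfIntegers (W := W) v').mpr hg)
    · exact Or.inr
        ((hasMultiplicativeReductionAtPrime_iff_hasMultiplicativeReductionAt_ringOfIntegers
          (W := W) v').mpr hm)
  exact key ⟨ℓ, hℓ⟩ hv

/-- `W.IsSemistable ℤ ↔ W.IsSemistable (𝓞 ℚ)` for an elliptic curve over `ℚ`.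
[cite: SilvermanAEC2009, VII.5 Prop. 5.1] -/
theorem isSemistable_int_iff_isSemistable_ringOfIntegers :
    W.IsSemistable ℤ ↔ W.IsSemistable (𝓞 ℚ) :=
  ⟨Literature.NumberTheory.DiophantineGeometry.isSemistable_ringOfIntegers_of_isSemistable_int W,
    isSemistable_int_of_isSemistable_ringOfIntegers W⟩

/-- `Semistable W ↔ W.IsSemistable (𝓞 ℚ)` — the spelling used by
`JetchevSkinnerWan2017.thm121_padicValRat_bsd_rank_one`. [cite: SilvermanAEC2009, VII.5 Prop. 5.1] -/
theorem semistable_iff_isSemistable_ringOfIntegers : Semistable W ↔ W.IsSemistable (𝓞 ℚ) :=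
  (semistable_iff_isSemistable_int W).trans (isSemistable_int_iff_isSemistable_ringOfIntegers W)

end Semistable

/-! ## 3. Print shapes: everything is `PPart` / `PPartRankZero` -/

section Shapes

variable (W : WeierstrassCurve ℚ) [W.IsElliptic] (p : ℕ) [Fact p.Prime]

omit [Fact p.Prime] in
/-- (a) ↔ (b): the quotient display `L^{(r)}(E,1)/r!/(Ω·Reg) = q` (`PPart`) versus the product
display `L^{(r)}(E,1)/r! = q·Reg·Ω` of Yan–Zhu Thm. 4.15 / JSW (1.2) (`bsdp_of_padicValRat_eq`,
`YanZhu2026.thm415_…`, `JetchevSkinnerWan2017.thm121_…`), same valuation identity; `Reg·Ω ≠ 0`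
(AEC VIII.9.7, `Ω_E > 0`). [cite: YanZhu2026, Thm. 4.15 (display)] [cite: SilvermanAEC2009, Cor. VIII.9.7] -/
theorem pPart_iff_productShape : PPart W p ↔
    ∃ q : ℚ, W.leadingLCoeff = (((q : ℝ) * W.regulator * W.realPeriodRat : ℝ) : ℂ) ∧
      padicValRat p q = (padicValNat p W.shaOrder : ℤ) + padicValNat p W.tamagawaProduct -
        2 * padicValNat p W.torsionOrder := by
  have hR : (W.regulator : ℂ) ≠ 0 := by exact_mod_cast (regulator_pos' W).ne'
  have hΩ : (W.realPeriodRat : ℂ) ≠ 0 := by exact_mod_cast W.realPeriodRat_pos_holds.ne'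
  have hD : ((W.realPeriodRat * W.regulator : ℝ) : ℂ) ≠ 0 := by
    push_cast
    exact mul_ne_zero hΩ hR
  constructor
  · rintro ⟨q, hq, hv⟩
    refine ⟨q, ?_, hv⟩
    rw [(div_eq_iff hD).mp hq]
    push_cast
    ring
  · rintro ⟨q, hq, hv⟩
    refine ⟨q, ?_, hv⟩
    rw [div_eq_iff hD, hq]
    push_cast
    ring

/-- (a) ↔ (c): under (irr) the torsion term vanishes (`ord_p #E(ℚ)_tors = 0`, Mazur), so `PPart`
is the no-torsion quotient display `ord_p (L^{(r)}(E,1)/r!/(Ω·Reg)) = ord_p #Ш + ord_p ∏ c_ℓ` of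
Castella 2018 Thm. A / BCS 2025 Cor. 1.3.1 / Skinner–Zhang (hypothesis shape of
`bsdp_of_padicVal_printShape`). [cite: Mazur1977, Ch. III §5, p. 157] [cite: BurungaleCastellaSkinner2025, Cor. 1.3.1 (display)] -/
theorem pPart_iff_noTorsionShape (hirr : W.HasIrreducibleModPGaloisRep p) : PPart W p ↔
    ∃ q : ℚ, W.leadingLCoeff / ((W.realPeriodRat * W.regulator : ℝ) : ℂ) = (q : ℂ) ∧
      padicValRat p q = (padicValNat p W.shaOrder : ℤ) + padicValNat p W.tamagawaProduct := by
  have htors : padicValNat p W.torsionOrder = 0 :=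
    padicValNat_torsionOrder_eq_zero_of_irreducible W p hirr
  constructor
  · rintro ⟨q, hq, hv⟩
    refine ⟨q, hq, ?_⟩
    rw [hv, htors]
    push_cast
    ring
  · rintro ⟨q, hq, hv⟩
    refine ⟨q, hq, ?_⟩
    rw [hv, htors]
    push_cast
    ring

/-- (a) ↔ (c′): the same no-torsion quotient display with the denominator spelled
`(Reg : ℂ)·(Ω : ℂ)` (the spelling of `JetchevSkinnerWan2017_padicValRat_bsd_rank_one_ordinary`),
under (irr). [cite: JetchevSkinnerWan2017, Thm. 1.2.1 (display (1.2))] [cite: Mazur1977, Ch. III §5, p. 157] -/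
theorem pPart_iff_noTorsionShape_regMulPeriod (hirr : W.HasIrreducibleModPGaloisRep p) : PPart W p ↔
    ∃ q : ℚ, W.leadingLCoeff / ((W.regulator : ℂ) * (W.realPeriodRat : ℂ)) = (q : ℂ) ∧
      padicValRat p q = (padicValNat p W.shaOrder : ℤ) + padicValNat p W.tamagawaProduct := by
  have hden : ((W.realPeriodRat * W.regulator : ℝ) : ℂ) =
      (W.regulator : ℂ) * (W.realPeriodRat : ℂ) := by
    push_cast
    ring
  rw [pPart_iff_noTorsionShape W p hirr, hden]

omit [W.IsElliptic] [Fact p.Prime] in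
/-- (d): `PPartRankZero` is VERBATIM the hypothesis shape of `bsdp_of_padicValRat_rank_zero`
(`LeadingTermPPartEisensteinProofs`) and the conclusion shape of
`Skinner2016.thmC_padicValRat_bsd_rank_zero` / `padicValRat_bsd_rank_zero` (Skinner–Urban Thm. 2):
`L(E,1)/Ω = q`, `ord_p q = ord_p #Ш + ord_p ∏ c_ℓ − 2 ord_p #E(ℚ)_tors`.
[cite: Skinner2016PacificMC, Thm. C (display)] -/
theorem pPartRankZero_iff_torsionShape : PPartRankZero W p ↔
    ∃ q : ℚ, W.entireLFunction 1 / (W.realPeriodRat : ℂ) = (q : ℂ) ∧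
      padicValRat p q = (padicValNat p W.shaOrder : ℤ) + padicValNat p W.tamagawaProduct -
        2 * padicValNat p W.torsionOrder :=
  Iff.rfl

/-- (d) ↔ (e): under (irr), `PPartRankZero` is the rank-`0` no-torsion display
`ord_p (L(E,1)/Ω) = ord_p #Ш + ord_p ∏ c_ℓ` (`Skinner2016_padicValRat_bsd_rank_zero`, hypothesis
shape of `bsdp_of_padicVal_printShape_rankZero`). [cite: Skinner2016PacificMC, Thm. C (display)] [cite: Mazur1977, Ch. III §5, p. 157] -/
theorem pPartRankZero_iff_noTorsionShape (hirr : W.HasIrreducibleModPGaloisRep p) :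
    PPartRankZero W p ↔
    ∃ q : ℚ, W.entireLFunction 1 / (W.realPeriodRat : ℂ) = (q : ℂ) ∧
      padicValRat p q = (padicValNat p W.shaOrder : ℤ) + padicValNat p W.tamagawaProduct := by
  have htors : padicValNat p W.torsionOrder = 0 :=
    padicValNat_torsionOrder_eq_zero_of_irreducible W p hirr
  constructor
  · rintro ⟨q, hq, hv⟩
    refine ⟨q, hq, ?_⟩
    rw [hv, htors]
    push_cast
    ring
  · rintro ⟨q, hq, hv⟩
    refine ⟨q, hq, ?_⟩
    rw [hv, htors]
    push_cast
    ring

end Shapes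

/-! ## 2. Jetchev–Skinner–Wan Thm. 1.2.1: the full spelling implies the ordinary spelling -/

section JSW

/-- **Dedup (R6.6)**: the cell's full transcription of JSW Thm. 1.2.1 implies the bsd-percentage
seat's ordinary-case transcription: semistable over `ℤ` ⇒ over `𝓞 ℚ`; `p ∤ a_p` makes the `p = 3`
clause vacuous; (irr) kills the torsion term; `Reg·Ω ≠ 0` turns the product display into the
quotient display. [cite: JetchevSkinnerWan2017, Thm. 1.2.1 (p. 370)] -/
theorem jsw_ordinary_of_thm121 (h : JetchevSkinnerWan2017.thm121_padicValRat_bsd_rank_one) :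
    JetchevSkinnerWan2017_padicValRat_bsd_rank_one_ordinary := by
  intro W _ _ p _ hp hss hgood hord hirr hrk hfin
  have hsst : W.IsSemistable (𝓞 ℚ) :=
    Literature.NumberTheory.DiophantineGeometry.isSemistable_ringOfIntegers_of_isSemistable_int W hss
  have h3 : p = 3 → (3 : ℤ) ∣ W.frobeniusTrace 3 → W.frobeniusTrace 3 = 0 := by
    rintro rfl h33
    exact absurd (by exact_mod_cast h33) hord
  obtain ⟨q, hq, hv⟩ := h W p hp hsst hgood h3 hirr hrk hfin
  have hprod : ∃ q : ℚ, W.leadingLCoeff = (((q : ℝ) * W.regulator * W.realPeriodRat : ℝ) : ℂ) ∧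
      padicValRat p q = (padicValNat p W.shaOrder : ℤ) + padicValNat p W.tamagawaProduct -
        2 * padicValNat p W.torsionOrder := ⟨q, hq, hv⟩
  exact (pPart_iff_noTorsionShape_regMulPeriod W p hirr).mp
    ((pPart_iff_productShape W p).mpr hprod)

/-- **Converse on the ordinary locus**: the ordinary-case spelling returns the printed display of
Thm. 1.2.1 (product form, torsion term) for `p ∤ a_p`, semistable over `𝓞 ℚ`.
[cite: JetchevSkinnerWan2017, Thm. 1.2.1 (p. 370), display (1.2)] -/
theorem JetchevSkinnerWan2017.thm121_display_of_ordinary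
    (h : JetchevSkinnerWan2017_padicValRat_bsd_rank_one_ordinary)
    (W : WeierstrassCurve ℚ) [W.IsElliptic] [W.IsGloballyMinimal] (p : ℕ) [Fact p.Prime]
    (hp : 3 ≤ p) (hsst : W.IsSemistable (𝓞 ℚ)) (hgood : W.HasGoodReductionAtPrime p)
    (hord : ¬ (p : ℤ) ∣ W.frobeniusTrace p) (hirr : W.HasIrreducibleModPGaloisRep p)
    (hr : W.analyticRank = 1) (hfin : Finite W.sha) :
    ∃ q : ℚ, W.leadingLCoeff = (((q : ℝ) * W.regulator * W.realPeriodRat : ℝ) : ℂ) ∧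
      padicValRat p q = (padicValNat p W.shaOrder : ℤ) + padicValNat p W.tamagawaProduct -
        2 * padicValNat p W.torsionOrder := by
  have hss : W.IsSemistable ℤ := isSemistable_int_of_isSemistable_ringOfIntegers W hsst
  exact (pPart_iff_productShape W p).mp
    ((pPart_iff_noTorsionShape_regMulPeriod W p hirr).mpr (h W p hp hss hgood hord hirr hr hfin))

end JSW

/-! ## 4. Skinner 2016 Thm. C: the cell's spelling (torsion term) ↔ the bsd-percentage spelling -/

section Skinner2016

/-- **Dedup (ARM P, cell `bsd-cited`)**: the two tree spellings of C. Skinner, Pacific J. Math. 283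
(2016) Thm. C (rank-`0` half) — `Skinner2016_padicValRat_bsd_rank_zero` (display without torsion
term, `ord_p(L(E,1)/Ω_E) = ord_p #Ш + ord_p ∏ c_ℓ`, as printed) and
`Skinner2016.thmC_padicValRat_bsd_rank_zero` (display with `− 2 ord_p #E(ℚ)_tors`) — are
EQUIVALENT: the hypotheses agree binder for binder and, under (irr), `ord_p #E(ℚ)_tors = 0`
(`padicValNat_torsionOrder_eq_zero_of_irreducible`, via `pPartRankZero_iff_noTorsionShape`). Hence a
referee reading of Thm. C against either name grades both (and, through
`Skinner2016.padicValRat_bsd_rank_zero_of_thmC`, the Skinner–Urban Thm. 2 (a) spelling).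
[cite: Skinner2016PacificMC, Thm. C (p. 173)] -/
theorem skinner2016_noTorsion_iff_thmC :
    Skinner2016_padicValRat_bsd_rank_zero ↔ Skinner2016.thmC_padicValRat_bsd_rank_zero := by
  constructor
  · intro h W _ _ p _ hp hred hirr hram hL hfin
    exact (pPartRankZero_iff_noTorsionShape W p hirr).mpr (h W p hp hred hirr hram hL hfin)
  · intro h W _ _ p _ hp hred hirr hram hL hfin
    exact (pPartRankZero_iff_noTorsionShape W p hirr).mp (h W p hp hred hirr hram hL hfin)

/-- Pointed form for consumers holding the H1 binder `hSk`: the bsd-percentage spelling follows.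
[cite: Skinner2016PacificMC, Thm. C (p. 173)] -/
theorem skinner2016_noTorsion_of_thmC (h : Skinner2016.thmC_padicValRat_bsd_rank_zero) :
    Skinner2016_padicValRat_bsd_rank_zero :=
  skinner2016_noTorsion_iff_thmC.mpr h

/-- Pointed form for consumers holding the bsd-percentage binder: the H1 spelling follows.
[cite: Skinner2016PacificMC, Thm. C (p. 173)] -/
theorem Skinner2016.thmC_of_noTorsion (h : Skinner2016_padicValRat_bsd_rank_zero) :
    Skinner2016.thmC_padicValRat_bsd_rank_zero :=
  skinner2016_noTorsion_iff_thmC.mp h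

end Skinner2016

end Literature.NumberTheory.EllipticCurves.Rank1Residual
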